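import Summits.Parity.GeneralizedHardyLittlewood.Theses.LiouvilleShiftedTables
import Summits.Parity.GeneralizedHardyLittlewood.Theorems.TableChowla.Negative.TableChowlaCornerDomination

/-!
# `TableChowla` (stmt-Parity-14270): the corner reduction `OffAxesCornerChowla → TableChowla`

Support lemma for the crux `LiouvilleShiftedTables.TableChowla` (cdisprove seat):
`tableChowla_of_offAxesCorners` — if every restricted corner sum of the table with gaps
`1 ≤ h, k < (log x)^K` is `≤ x/(log x)^K` in absolute value (for every `K`, eventually, uniformly in
the window), then the crux holds (`K = C + 1`, `H = K = ⌊(log x)^{C+1}⌋` in `corner_domination`: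
`T ≤ 192·x²/(log x)^{C+1}`). This is the first lemma of crux idea `corner-local-box` with its
hypothesis REPAIRED (both gaps non-zero; all four corners inside the table). [folklore]
-/

namespace Summit.Parity.GeneralizedHardyLittlewood.Theorems.TableChowla.Negative

open Finset Real ArithmeticFunction
open Summit.Parity.GeneralizedHardyLittlewood.Theses

noncomputable section

/-- OFF-AXES CORNER CHOWLA — the REPAIRED transfer target of card `corner-local-box`, in
restricted form (all four corners inside the table; both gaps `h, k ≥ 1`): every restricted
corner sum with gaps below `(log x)^K` is `≤ x/(log x)^K` in absolute value. Each is, by the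
card's `block_det`, a binary Chowla sum `Σ_{a,b} λ(Q)λ(Q + hkc)` at the FIXED tiny shift `hkc`. -/
def OffAxesCornerChowla : Prop :=
  ∀ c : ℤ, c ≠ 0 → ∀ δ : ℝ, 0 < δ → δ ≤ 1 / 12 → ∀ K : ℝ, 0 < K → ∃ x₀ : ℝ, ∀ x : ℝ, x₀ ≤ x →
    ∀ A : ℝ, x ^ δ ≤ A → A ≤ x ^ (1 / 3 + δ) → ∀ h k : ℕ, 1 ≤ h → (h : ℝ) < Real.log x ^ K →
      1 ≤ k → (k : ℝ) < Real.log x ^ K →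
        |cornerRes lam c ⌊A⌋₊ ⌊2 * A⌋₊ ⌊x / A⌋₊ h k| ≤ x / Real.log x ^ K

/-- **CORNER REDUCTION, PROVED**: `OffAxesCornerChowla → TableChowla` (take `K = C + 1`,
`H = K = ⌊(log x)^{C+1}⌋`; corner domination gives `T ≤ 192·x²/(log x)^{C+1}`). This is the
first lemma `localBox_reduction` of card `corner-local-box` with its hypothesis REPAIRED
(`h ≠ 0 ∧ k ≠ 0`; restricted corners). -/
theorem tableChowla_of_offAxesCorners (h : OffAxesCornerChowla) : LiouvilleShiftedTables.TableChowla := by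
  rw [tableChowla_iff]
  intro c hc δ hδ hδ' C hC
  obtain ⟨x₀, hx₀⟩ := h c hc δ hδ hδ' (C + 1) (by linarith)
  obtain ⟨X₁, hX₁⟩ := eventually_log_rpow_le hδ (C + 1)
  refine ⟨max (max x₀ 4096) (max X₁ (Real.exp 192)), fun x hx A hA hA' => ?_⟩
  have hx₀x : x₀ ≤ x := le_trans (le_trans (le_max_left _ _) (le_max_left _ _)) hx
  have hx4096 : (4096 : ℝ) ≤ x := le_trans (le_trans (le_max_right _ _) (le_max_left _ _)) hx
  have hxX₁ : X₁ ≤ x := le_trans (le_trans (le_max_left _ _) (le_max_right _ _)) hx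
  have hxe : Real.exp 192 ≤ x := le_trans (le_trans (le_max_right _ _) (le_max_right _ _)) hx
  have hx1 : (1 : ℝ) ≤ x := by linarith
  have hxpos : 0 < x := by linarith
  have hlog : 192 ≤ Real.log x := (Real.le_log_iff_exp_le hxpos).mpr hxe
  have hlogpos : 0 < Real.log x := by linarith
  obtain ⟨h4, _⟩ := hX₁ x hxX₁
  have hAone : 1 ≤ A := le_trans (Real.one_le_rpow hx1 hδ.le) hA
  have hApos : 0 < A := by linarith
  -- Lr := (log x)^(C+1), Hn := ⌊Lr⌋
  set Lr : ℝ := Real.log x ^ (C + 1) with hLr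
  have hLrge : 192 ≤ Lr := by
    calc (192 : ℝ) ≤ Real.log x := hlog
      _ = Real.log x ^ (1 : ℝ) := (Real.rpow_one _).symm
      _ ≤ Lr := by rw [hLr]; exact Real.rpow_le_rpow_of_exponent_le (by linarith) (by linarith)
  set Hn : ℕ := ⌊Lr⌋₊ with hHndef
  have hHn1 : 1 ≤ Hn := by rw [hHndef, Nat.one_le_floor_iff]; linarith
  have hHnle : (Hn : ℝ) ≤ Lr := Nat.floor_le (by linarith)
  have hHnge : Lr / 2 ≤ Hn := by
    have := Nat.lt_floor_add_one Lr; rw [← hHndef] at this; linarith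
  have hHnpos : (0 : ℝ) < Hn := by exact_mod_cast hHn1
  have hLrA : Lr ≤ A := by linarith
  -- Bn and Hn ≤ Bn
  set Bn : ℕ := ⌊x / A⌋₊ with hBn
  have hBle : (Bn : ℝ) ≤ x / A := Nat.floor_le (by positivity)
  have hBge : x / A - 1 < Bn := by have := Nat.lt_floor_add_one (x / A); rw [← hBn] at this; linarith
  have hxA : x ^ ((7 : ℝ) / 12) ≤ x / A := by
    rw [le_div_iff₀ hApos]
    calc x ^ ((7 : ℝ) / 12) * A ≤ x ^ ((7 : ℝ) / 12) * x ^ (1 / 3 + δ) :=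
          mul_le_mul_of_nonneg_left hA' (by positivity)
      _ = x ^ ((7 : ℝ) / 12 + (1 / 3 + δ)) := by rw [← Real.rpow_add hxpos]
      _ ≤ x ^ (1 : ℝ) := Real.rpow_le_rpow_of_exponent_le hx1 (by linarith)
      _ = x := Real.rpow_one x
  have hx712 : x ^ δ ≤ x ^ ((7 : ℝ) / 12) := Real.rpow_le_rpow_of_exponent_le hx1 (by linarith)
  have hHnB : (Hn : ℝ) ≤ Bn := by nlinarith
  -- the corner hypothesis at this (x, A)
  set Mx : ℝ := x / Lr with hMx
  have hMx0 : 0 ≤ Mx := by positivity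
  have hcorner : ∀ h ∈ Finset.Ico 1 Hn, ∀ k ∈ Finset.Ico 1 Hn,
      |cornerRes lam c ⌊A⌋₊ ⌊2 * A⌋₊ Bn h k| ≤ Mx := by
    intro h hh k hk
    rw [Finset.mem_Ico] at hh hk
    have hh' : (h : ℝ) < Lr := lt_of_lt_of_le (by exact_mod_cast hh.2) hHnle
    have hk' : (k : ℝ) < Lr := lt_of_lt_of_le (by exact_mod_cast hk.2) hHnle
    have := hx₀ x hx₀x A hA hA' h k hh.1 hh' hk.1 hk'
    rw [← hBn] at this
    exact this
  have hdom := corner_domination (f := lam) (c := c) (A₁ := ⌊A⌋₊) (A₂ := ⌊2 * A⌋₊) (B := Bn)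
    abs_lam_le_one hHn1 hHn1 hMx0 hcorner
  -- sizes: N' ≤ 3A (indeed ≤ 2A + Hn), B' ≤ 2 Bn, rows ≤ 2A, Bn ≤ x/A
  have hrows : ((Ioc ⌊A⌋₊ ⌊2 * A⌋₊).card : ℝ) ≤ 2 * A := by
    rw [Nat.card_Ioc, Nat.cast_sub (Nat.floor_le_floor (by linarith : A ≤ 2 * A))]
    have h1 : (⌊2 * A⌋₊ : ℝ) ≤ 2 * A := Nat.floor_le (by linarith)
    have h2 : A - 1 < (⌊A⌋₊ : ℝ) := by have := Nat.lt_floor_add_one A; linarith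
    linarith
  have hN' : ((⌊2 * A⌋₊ + Hn - 1 - ⌊A⌋₊ : ℕ) : ℝ) ≤ 3 * A := by
    have h1 : (⌊2 * A⌋₊ : ℝ) ≤ 2 * A := Nat.floor_le (by linarith)
    have h2 : ((⌊2 * A⌋₊ + Hn - 1 - ⌊A⌋₊ : ℕ) : ℝ) ≤ ((⌊2 * A⌋₊ + Hn : ℕ) : ℝ) := by
      exact_mod_cast (show ⌊2 * A⌋₊ + Hn - 1 - ⌊A⌋₊ ≤ ⌊2 * A⌋₊ + Hn by omega)
    push_cast at h2
    linarith
  have hB' : ((Bn + Hn - 1 : ℕ) : ℝ) ≤ 2 * Bn := by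
    have h2 : ((Bn + Hn - 1 : ℕ) : ℝ) ≤ ((Bn + Hn : ℕ) : ℝ) := by exact_mod_cast Nat.sub_le _ _
    push_cast at h2
    linarith
  have hABx : A * (Bn : ℝ) ≤ x := by
    calc A * (Bn : ℝ) ≤ A * (x / A) := mul_le_mul_of_nonneg_left hBle hApos.le
      _ = x := by field_simp
  -- arithmetic on opaque reals: Hn⁴ T ≤ N' B' (2 N Bn Hn Hn² + 4 N Bn Hn² Hn + 4 Hn⁴ Mx) ⟹ Lr T ≤ 192 x²
  have arith : ∀ (T n' b' n bn hn a xx lr mx : ℝ),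
      hn ^ 2 * hn ^ 2 * T ≤ n' * b' * (2 * n * bn * hn * hn ^ 2 + 4 * n * bn * hn ^ 2 * hn + 4 * hn ^ 2 * hn ^ 2 * mx) →
      0 < hn → n' ≤ 3 * a → b' ≤ 2 * bn → n ≤ 2 * a → a * bn ≤ xx → 0 ≤ n' → 0 ≤ b' → 0 ≤ n → 0 ≤ bn → 0 ≤ a →
      0 ≤ T → 0 ≤ mx → lr / 2 ≤ hn → hn ≤ lr → lr * mx = xx → 0 ≤ xx →
      lr * T ≤ 192 * xx ^ 2 := by
    intro T n' b' n bn hn a xx lr mx h1 hhn hn' hb' hnle hab hn'0 hb'0 hn0 hbn0 ha0 hT0 hmx0 hlr1 hlr2 hlrmx hxx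
    have habn : 0 ≤ a * bn := mul_nonneg ha0 hbn0
    have hhn0 : 0 ≤ hn := hhn.le
    have hbracket : 0 ≤ 2 * n * bn * hn * hn ^ 2 + 4 * n * bn * hn ^ 2 * hn + 4 * hn ^ 2 * hn ^ 2 * mx := by positivity
    -- step A: n' b' ≤ 6 a bn
    have hA1 : n' * b' ≤ 6 * (a * bn) := by
      calc n' * b' ≤ (3 * a) * (2 * bn) := mul_le_mul hn' hb' hb'0 (by positivity)
        _ = 6 * (a * bn) := by ring
    have hA2 : hn ^ 2 * hn ^ 2 * T ≤ 6 * (a * bn) * (2 * n * bn * hn * hn ^ 2 + 4 * n * bn * hn ^ 2 * hn + 4 * hn ^ 2 * hn ^ 2 * mx) :=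
      le_trans h1 (mul_le_mul_of_nonneg_right hA1 hbracket)
    -- step B: the bracket ≤ hn³ (12 a bn + 4 hn mx)
    have hnbn : n * bn ≤ 2 * a * bn := mul_le_mul_of_nonneg_right hnle hbn0
    have hA3 : 2 * n * bn * hn * hn ^ 2 + 4 * n * bn * hn ^ 2 * hn + 4 * hn ^ 2 * hn ^ 2 * mx ≤
        hn ^ 3 * (12 * (a * bn) + 4 * hn * mx) := by
      have hh3 : 0 ≤ hn ^ 3 := pow_nonneg hhn0 3
      calc 2 * n * bn * hn * hn ^ 2 + 4 * n * bn * hn ^ 2 * hn + 4 * hn ^ 2 * hn ^ 2 * mx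
          = hn ^ 3 * (6 * (n * bn)) + 4 * hn ^ 3 * hn * mx := by ring
        _ ≤ hn ^ 3 * (6 * (2 * a * bn)) + 4 * hn ^ 3 * hn * mx := by
            have := mul_le_mul_of_nonneg_left (mul_le_mul_of_nonneg_left hnbn (by norm_num : (0:ℝ) ≤ 6)) hh3
            linarith
        _ = hn ^ 3 * (12 * (a * bn) + 4 * hn * mx) := by ring
    have hA4 : hn ^ 2 * hn ^ 2 * T ≤ 6 * (a * bn) * (hn ^ 3 * (12 * (a * bn) + 4 * hn * mx)) :=
      le_trans hA2 (mul_le_mul_of_nonneg_left hA3 (by positivity))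
    -- step C: divide by hn³
    have hA5 : hn * T ≤ 6 * (a * bn) * (12 * (a * bn) + 4 * hn * mx) := by
      have hh3 : 0 < hn ^ 3 := pow_pos hhn 3
      have : hn ^ 3 * (hn * T) ≤ hn ^ 3 * (6 * (a * bn) * (12 * (a * bn) + 4 * hn * mx)) := by
        calc hn ^ 3 * (hn * T) = hn ^ 2 * hn ^ 2 * T := by ring
          _ ≤ _ := hA4
          _ = _ := by ring
      exact le_of_mul_le_mul_left this hh3
    -- step D: a bn ≤ xx
    have hA6 : hn * T ≤ 72 * xx ^ 2 + 24 * xx * (hn * mx) := by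
      have hsq : (a * bn) ^ 2 ≤ xx ^ 2 := pow_le_pow_left₀ habn hab 2
      have hcross : (a * bn) * (hn * mx) ≤ xx * (hn * mx) := mul_le_mul_of_nonneg_right hab (mul_nonneg hhn0 hmx0)
      calc hn * T ≤ 6 * (a * bn) * (12 * (a * bn) + 4 * hn * mx) := hA5
        _ = 72 * (a * bn) ^ 2 + 24 * ((a * bn) * (hn * mx)) := by ring
        _ ≤ 72 * xx ^ 2 + 24 * (xx * (hn * mx)) := by linarith
        _ = 72 * xx ^ 2 + 24 * xx * (hn * mx) := by ring
    -- step E: lr T ≤ 2 hn T and hn mx ≤ lr mx = xx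
    have hA7 : xx * (hn * mx) ≤ xx * (lr * mx) := mul_le_mul_of_nonneg_left (mul_le_mul_of_nonneg_right hlr2 hmx0) hxx
    rw [hlrmx] at hA7
    have hA8 : lr * T ≤ 2 * (hn * T) := by
      have := mul_le_mul_of_nonneg_right hlr1 hT0
      linarith
    calc lr * T ≤ 2 * (hn * T) := hA8
      _ ≤ 2 * (72 * xx ^ 2 + 24 * xx * (hn * mx)) := by linarith
      _ = 144 * xx ^ 2 + 48 * (xx * (hn * mx)) := by ring
      _ ≤ 144 * xx ^ 2 + 48 * (xx * xx) := by linarith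
      _ = 192 * xx ^ 2 := by ring
  have hfin := arith _ _ _ _ _ _ _ _ _ _ hdom hHnpos hN' hB' hrows hABx (Nat.cast_nonneg _) (Nat.cast_nonneg _)
    (Nat.cast_nonneg _) (Nat.cast_nonneg _) hApos.le momentN_nonneg hMx0 hHnge hHnle
    (by rw [hMx]; field_simp) hxpos.le
  -- Lr T ≤ 192 x², Lr = (log x)^C · log x, log x ≥ 192
  have hsplit : Lr = Real.log x ^ C * Real.log x := by rw [hLr, Real.rpow_add hlogpos, Real.rpow_one]
  have hLpos : 0 < Real.log x ^ C := Real.rpow_pos_of_pos hlogpos C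
  show momentN lam c ⌊A⌋₊ ⌊2 * A⌋₊ ⌊x / A⌋₊ ≤ x ^ 2 / Real.log x ^ C
  rw [← hBn, le_div_iff₀ hLpos]
  rw [hsplit] at hfin
  have hT0 : 0 ≤ momentN lam c ⌊A⌋₊ ⌊2 * A⌋₊ Bn := momentN_nonneg
  have h2 : momentN lam c ⌊A⌋₊ ⌊2 * A⌋₊ Bn * Real.log x ^ C * Real.log x ≤ x ^ 2 * Real.log x := by
    calc momentN lam c ⌊A⌋₊ ⌊2 * A⌋₊ Bn * Real.log x ^ C * Real.log x
        = Real.log x ^ C * Real.log x * momentN lam c ⌊A⌋₊ ⌊2 * A⌋₊ Bn := by ring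
      _ ≤ 192 * x ^ 2 := hfin
      _ ≤ Real.log x * x ^ 2 := mul_le_mul_of_nonneg_right hlog (sq_nonneg x)
      _ = x ^ 2 * Real.log x := by ring
  exact le_of_mul_le_mul_right h2 hlogpos

end

end Summit.Parity.GeneralizedHardyLittlewood.Theorems.TableChowla.Negative
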